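import Literature.NumberTheory.Automorphic.BrandtModuleChains
import Literature.NumberTheory.Automorphic.BrandtWeightSymmetryLocal
import HarnessLib

/-!
# The Hecke recursion for Brandt matrices at a prime, from a fibre count

Sixteenth layer of the proof files for the named fact `brandtMatrix_comm` of `BrandtModule.lean`
(Vignéras, LNM 800, III §5 ex. 5.8 (c); Eichler 1973, II §6 Thm. 2 (19)). By the chain formula
(`BrandtData.ofOrder_T_mul_T_apply`) the entry `(B(m) B(n))_{ik}` counts chains
`I_i ⊇ J ⊇ K`; regrouping by `K ∈ Sub(I_i, mn)` (`chainEquivSigma`) gives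
`(B(m) B(n))_{ik} = ∑_K #Fibre(K)`, `Fibre(K) = {J ∈ Sub(I_i, m) | K ⊆ J}`. If, at a prime `p`,
every fibre over `K ∈ Sub(I, p^{a+2})` inside `Sub(I, p^{a+1})` has `c + 1` elements when
`K ⊆ p I` and `1` element otherwise (the local computation of the next layers: `c = p` at a
residually split prime, `c = 0` at a residually ramified one), then

* `BrandtData.ofOrder_T_pow_succ_mul_T` — **`B(p^{a+1}) B(p) = B(p^{a+2}) + c B(p^a)`**
  (`K ⊆ p I` iff `K = p K'` with `K' ∈ Sub(I, p^a)`, `pSubEquiv`), and hence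
* `BrandtData.ofOrder_commute_T_prime_pow` — **`B(p^a)` and `B(p^b)` commute** (each is a
  polynomial in `B(p)`; `commute_of_recursion`).

## References

* M.-F. Vignéras, *Arithmétique des algèbres de quaternions*, LNM 800 (1980), Ch. III §5
  exercice 5.8 (c): `P(p^a) P(p^b) = ∑ N(p)^n P(p^{a+b-2n}) L(p⁻¹)^n` [VignerasLNM800].
* M. Eichler, LNM 320 (1973), Ch. II §6 Thm. 2 (19) [Eichler1973].
-/

noncomputable section

open scoped Pointwise

universe u

namespace Literature.NumberTheory.Automorphic

/-! ### Commuting families from a three-term recursion -/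

section Algebra

variable {R : Type*} [Ring R]

/-- **A three-term recursion produces a commuting family**: if `X 0 = 1` and
`X (a+2) = X (a+1) X 1 − c X a` then all `X a` commute (each `X a` is a polynomial in `X 1`). [folklore] -/
theorem commute_of_recursion (X : ℕ → R) (c : R) (hc : ∀ a, Commute c (X a)) (h0 : X 0 = 1)
    (hrec : ∀ a, X (a + 2) = X (a + 1) * X 1 - c * X a) : ∀ a b, Commute (X a) (X b) := by
  -- every `X a` commutes with `X 1`
  have h1 : ∀ a, Commute (X a) (X 1) := by
    intro a
    induction a using Nat.strong_induction_on with
    | _ a ih =>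
      match a with
      | 0 => rw [h0]; exact Commute.one_left _
      | 1 => exact Commute.refl _
      | a + 2 =>
        rw [hrec]
        exact ((ih (a + 1) (by omega)).mul_left (Commute.refl _)).sub_left
          ((hc 1).mul_left (ih a (by omega)))
  intro a b
  induction b using Nat.strong_induction_on with
  | _ b ih =>
    match b with
    | 0 => rw [h0]; exact Commute.one_right _
    | 1 => exact h1 a
    | b + 2 =>
      rw [hrec]
      exact ((ih (b + 1) (by omega)).mul_right (h1 a)).sub_right ((hc a).symm.mul_right (ih b (by omega)))

end Algebra

variable {B : Type u} [Ring B] [Algebra ℚ B] [IsQuaternionAlgebra ℚ B] {O : Submodule ℤ B}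

/-! ### Scalars as units -/

omit [IsQuaternionAlgebra ℚ B] in
/-- A non-zero natural number is a unit of a `ℚ`-algebra. [folklore] -/
theorem exists_units_eq_natCast {n : ℕ} (hn : n ≠ 0) : ∃ u : Bˣ, (u : B) = n := by
  have hu : IsUnit (algebraMap ℚ B n) := (IsUnit.mk0 (n : ℚ) (by exact_mod_cast hn)).map _
  exact ⟨hu.unit, by rw [hu.unit_spec, map_natCast]⟩

omit [Algebra ℚ B] [IsQuaternionAlgebra ℚ B] in
/-- For a scalar unit `u = n`, `u • I = n • I`. [folklore] -/
theorem units_smul_eq_natCast_smul {n : ℕ} {u : Bˣ} (hu : (u : B) = n) (I : Submodule ℤ B) :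
    u • I = (n : ℤ) • I := by
  ext z
  constructor
  · intro hz
    obtain ⟨x, hx, rfl⟩ := (Submodule.mem_smul_pointwise_iff_exists z u I).mp hz
    refine (Submodule.mem_smul_pointwise_iff_exists _ _ I).mpr ⟨x, hx, ?_⟩
    rw [Units.smul_def, hu, smul_eq_mul, ← nsmul_eq_mul, natCast_zsmul]
  · intro hz
    obtain ⟨x, hx, rfl⟩ := (Submodule.mem_smul_pointwise_iff_exists _ _ I).mp hz
    refine (Submodule.mem_smul_pointwise_iff_exists _ u I).mpr ⟨x, hx, ?_⟩
    rw [Units.smul_def, hu, smul_eq_mul, ← nsmul_eq_mul, natCast_zsmul]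

omit [Algebra ℚ B] [IsQuaternionAlgebra ℚ B] in
/-- `n • I ≤ I`. [folklore] -/
theorem zsmul_le (n : ℤ) (I : Submodule ℤ B) : n • I ≤ I := fun x hx => by
  obtain ⟨y, hy, rfl⟩ := (Submodule.mem_smul_pointwise_iff_exists _ _ I).mp hx
  exact I.smul_mem n hy

omit [Algebra ℚ B] [IsQuaternionAlgebra ℚ B] in
/-- `n • K ≤ n • I` for `K ≤ I`. [folklore] -/
theorem zsmul_mono (n : ℤ) {K I : Submodule ℤ B} (h : K ≤ I) : n • K ≤ n • I := fun x hx => by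
  obtain ⟨y, hy, rfl⟩ := (Submodule.mem_smul_pointwise_iff_exists _ _ K).mp hx
  exact Submodule.smul_mem_pointwise_smul _ _ I (h hy)

omit [Algebra ℚ B] [IsQuaternionAlgebra ℚ B] in
/-- For a scalar unit `u = n`: `u • K ≤ K`. [folklore] -/
theorem units_smul_le_self {n : ℕ} {u : Bˣ} (hu : (u : B) = n) (K : Submodule ℤ B) : u • K ≤ K := by
  rw [units_smul_eq_natCast_smul hu]; exact zsmul_le _ _

/-! ### Regrouping chains by their last term -/

/-- **The fibre** of the chain map over `K`: the sub-ideals `J ∈ Sub(I, m)` containing `K`. [folklore] -/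
abbrev Fibre (O I : Submodule ℤ B) (m : ℕ) (K : Submodule ℤ B) : Type u :=
  {J : Subideal O I m // K ≤ ((J.1 : invertibleRightIdeals O) : Submodule ℤ B)}

omit [Algebra ℚ B] [IsQuaternionAlgebra ℚ B] in
/-- Index bookkeeping: `[I : N] = (mn)²` for `N ⊆ M ⊆ I` with `[I : M] = m²`, `[M : N] = n²`. [folklore] -/
theorem relIndex_chain {N M I : Submodule ℤ B} {m n : ℕ} (hNM : N ≤ M) (hMI : M ≤ I)
    (hM : M.toAddSubgroup.relIndex I.toAddSubgroup = m ^ 2) (hN : N.toAddSubgroup.relIndex M.toAddSubgroup = n ^ 2) :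
    N.toAddSubgroup.relIndex I.toAddSubgroup = (m * n) ^ 2 := by
  rw [← AddSubgroup.relIndex_mul_relIndex _ _ _ (Submodule.toAddSubgroup_mono hNM)
    (Submodule.toAddSubgroup_mono hMI), hN, hM]
  ring

omit [Algebra ℚ B] [IsQuaternionAlgebra ℚ B] in
/-- Index bookkeeping, converse: `[M : N] = n²` for `N ⊆ M ⊆ I` with `[I : M] = m² ≠ 0`,
`[I : N] = (mn)²`. [folklore] -/
theorem relIndex_of_chain {N M I : Submodule ℤ B} {m n : ℕ} (hm : m ≠ 0) (hNM : N ≤ M) (hMI : M ≤ I)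
    (hM : M.toAddSubgroup.relIndex I.toAddSubgroup = m ^ 2) (hN : N.toAddSubgroup.relIndex I.toAddSubgroup = (m * n) ^ 2) :
    N.toAddSubgroup.relIndex M.toAddSubgroup = n ^ 2 := by
  have h := AddSubgroup.relIndex_mul_relIndex _ _ _ (Submodule.toAddSubgroup_mono hNM)
    (Submodule.toAddSubgroup_mono hMI)
  rw [hN, hM, show (m * n) ^ 2 = n ^ 2 * m ^ 2 by ring] at h
  exact Nat.eq_of_mul_eq_mul_right (pow_pos (Nat.pos_of_ne_zero hm) 2) h

omit [Algebra ℚ B] [IsQuaternionAlgebra ℚ B] in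
/-- **Regrouping chains by their last term**: `Chain(I, m, n, k) ≃ Σ_{K ∈ Sub(I, mn), [K] = k} Fibre(K)`. [folklore] -/
def chainEquivSigma (O I : Submodule ℤ B) {m : ℕ} (hm : m ≠ 0) (n : ℕ) (k : RightIdealClass O) :
    Chain O I m n k ≃
      Σ K : {K : Subideal O I (m * n) // RightIdealClass.mk K.1 = k}, Fibre O I m ((K.1.1 : invertibleRightIdeals O) : Submodule ℤ B) where
  toFun x := ⟨⟨⟨x.2.1.1, x.2.1.le.trans x.1.le, relIndex_chain x.2.1.le x.1.le x.1.relIndex_eq x.2.1.relIndex_eq⟩, x.2.2⟩,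
    ⟨x.1, x.2.1.le⟩⟩
  invFun y := ⟨y.2.1, ⟨⟨y.1.1.1, y.2.2, relIndex_of_chain hm y.2.2 y.2.1.le y.2.1.relIndex_eq y.1.1.relIndex_eq⟩, y.1.2⟩⟩
  left_inv _ := rfl
  right_inv _ := rfl

omit [Algebra ℚ B] [IsQuaternionAlgebra ℚ B] in
/-- **`(B(m) B(n))_{ik} = ∑_{K ∈ Sub(I_i, mn), [K] = k} #Fibre(K)`** (as a cardinality of a sigma type). [folklore] -/
theorem card_chain_eq_card_sigma (O I : Submodule ℤ B) {m : ℕ} (hm : m ≠ 0) (n : ℕ) (k : RightIdealClass O) :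
    Nat.card (Chain O I m n k) =
      Nat.card (Σ K : {K : Subideal O I (m * n) // RightIdealClass.mk K.1 = k},
        Fibre O I m ((K.1.1 : invertibleRightIdeals O) : Submodule ℤ B)) :=
  Nat.card_congr (chainEquivSigma O I hm n k)

/-! ### `K ⊆ p I` iff `K = p K'` -/

/-- `p K'` for `K' ∈ Sub(I, p^a)` is in `Sub(I, p^{a+1} p)`. [folklore] -/
def pSub (O I : Submodule ℤ B) {p : ℕ} {u : Bˣ} (hu : (u : B) = p) {a : ℕ} (K' : Subideal O I (p ^ a)) :
    Subideal O I (p ^ (a + 1) * p) :=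
  ⟨⟨u • ((K'.1 : invertibleRightIdeals O) : Submodule ℤ B), K'.1.2.units_smul u⟩,
    (units_smul_le_self hu _).trans K'.le, by
      have h4 := BrandtModule.relIndex_natCast_units_smul K'.1.2.isFullLattice hu
      change (u • ((K'.1 : invertibleRightIdeals O) : Submodule ℤ B)).toAddSubgroup.relIndex I.toAddSubgroup = _
      rw [← AddSubgroup.relIndex_mul_relIndex _ _ _ (Submodule.toAddSubgroup_mono (units_smul_le_self hu _))
        (Submodule.toAddSubgroup_mono K'.le), h4, K'.relIndex_eq]
      ring⟩

/-- The underlying lattice of `pSub K'` is `u • K'`. [folklore] -/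
theorem coe_pSub (O I : Submodule ℤ B) {p : ℕ} {u : Bˣ} (hu : (u : B) = p) {a : ℕ} (K' : Subideal O I (p ^ a)) :
    (((pSub O I hu K').1 : invertibleRightIdeals O) : Submodule ℤ B) = u • ((K'.1 : invertibleRightIdeals O) : Submodule ℤ B) := rfl

/-- `p⁻¹ K` for `K ∈ Sub(I, p^{a+1} p)` with `K ⊆ p I` is in `Sub(I, p^a)`. [folklore] -/
def pSubInv (O I : Submodule ℤ B) {p : ℕ} (hp : p.Prime) {u : Bˣ} (hu : (u : B) = p) {a : ℕ}
    (K : Subideal O I (p ^ (a + 1) * p)) (hK : ((K.1 : invertibleRightIdeals O) : Submodule ℤ B) ≤ (p : ℤ) • I) :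
    Subideal O I (p ^ a) :=
  ⟨⟨u⁻¹ • ((K.1 : invertibleRightIdeals O) : Submodule ℤ B), K.1.2.units_smul u⁻¹⟩, by
      have h : ((K.1 : invertibleRightIdeals O) : Submodule ℤ B) ≤ u • I := by
        rw [units_smul_eq_natCast_smul hu]; exact hK
      simpa using units_smul_mono u⁻¹ h, by
      change (u⁻¹ • ((K.1 : invertibleRightIdeals O) : Submodule ℤ B)).toAddSubgroup.relIndex I.toAddSubgroup = _
      have hfull : IsFullLattice B (u⁻¹ • ((K.1 : invertibleRightIdeals O) : Submodule ℤ B)) :=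
        (K.1.2.units_smul u⁻¹).isFullLattice
      have h4 := BrandtModule.relIndex_natCast_units_smul hfull hu
      rw [smul_inv_smul] at h4
      have hle : u⁻¹ • ((K.1 : invertibleRightIdeals O) : Submodule ℤ B) ≤ I := by
        have h : ((K.1 : invertibleRightIdeals O) : Submodule ℤ B) ≤ u • I := by
          rw [units_smul_eq_natCast_smul hu]; exact hK
        simpa using units_smul_mono u⁻¹ h
      have hKle : ((K.1 : invertibleRightIdeals O) : Submodule ℤ B) ≤ u⁻¹ • ((K.1 : invertibleRightIdeals O) : Submodule ℤ B) := by
        have := units_smul_le_self hu (u⁻¹ • ((K.1 : invertibleRightIdeals O) : Submodule ℤ B))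
        rwa [smul_inv_smul] at this
      have hch := AddSubgroup.relIndex_mul_relIndex _ _ _ (Submodule.toAddSubgroup_mono hKle)
        (Submodule.toAddSubgroup_mono hle)
      have hch' : p ^ 4 * (u⁻¹ • ((K.1 : invertibleRightIdeals O) : Submodule ℤ B)).toAddSubgroup.relIndex I.toAddSubgroup =
          p ^ 4 * (p ^ a) ^ 2 :=
        calc _ = _ := by rw [← h4]
          _ = _ := hch
          _ = (p ^ (a + 1) * p) ^ 2 := K.relIndex_eq
          _ = p ^ 4 * (p ^ a) ^ 2 := by ring
      exact Nat.eq_of_mul_eq_mul_left (pow_pos hp.pos 4) hch'⟩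

/-- The underlying lattice of `pSubInv K` is `u⁻¹ • K`. [folklore] -/
theorem coe_pSubInv (O I : Submodule ℤ B) {p : ℕ} (hp : p.Prime) {u : Bˣ} (hu : (u : B) = p) {a : ℕ}
    (K : Subideal O I (p ^ (a + 1) * p)) (hK : ((K.1 : invertibleRightIdeals O) : Submodule ℤ B) ≤ (p : ℤ) • I) :
    (((pSubInv O I hp hu K hK).1 : invertibleRightIdeals O) : Submodule ℤ B) =
      u⁻¹ • ((K.1 : invertibleRightIdeals O) : Submodule ℤ B) := rfl

/-- **Sub-ideals inside `p I`**: `K' ↦ p K'` is a bijection from `Sub(I, p^a)` onto the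
`K ∈ Sub(I, p^{a+1} p)` with `K ⊆ p I`, preserving classes (`p` is central). [folklore] -/
def pSubEquiv (O I : Submodule ℤ B) {p : ℕ} (hp : p.Prime) {u : Bˣ} (hu : (u : B) = p) (a : ℕ)
    (k : RightIdealClass O) :
    {K' : Subideal O I (p ^ a) // RightIdealClass.mk K'.1 = k} ≃
      {K : Subideal O I (p ^ (a + 1) * p) //
        ((K.1 : invertibleRightIdeals O) : Submodule ℤ B) ≤ (p : ℤ) • I ∧ RightIdealClass.mk K.1 = k} where
  toFun K' := ⟨pSub O I hu K'.1,
    ⟨by rw [coe_pSub, units_smul_eq_natCast_smul hu]; exact zsmul_mono _ K'.1.le,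
      (RightIdealClass.mk_units_smul u K'.1.1).trans K'.2⟩⟩
  invFun K := ⟨pSubInv O I hp hu K.1 K.2.1, (RightIdealClass.mk_units_smul u⁻¹ K.1.1).trans K.2.2⟩
  left_inv K' := by
    apply Subtype.ext; apply Subideal.ext
    rw [coe_pSubInv, coe_pSub, inv_smul_smul]
  right_inv K := by
    apply Subtype.ext; apply Subideal.ext
    rw [coe_pSub, coe_pSubInv, smul_inv_smul]

/-! ### The recursion -/

/-- **Hecke recursion from a fibre count**: if every fibre of `Sub(I_i, p^{a+1}) → Sub(I_i, p^{a+2})`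
has `c + 1` elements over `K ⊆ p I_i` and `1` element otherwise, then
`B(p^{a+1}) B(p) = B(p^{a+1} p) + c B(p^a)`. [cite: VignerasLNM800, Ch. III §5 exercice 5.8 (c)] -/
theorem BrandtData.ofOrder_T_pow_succ_mul_T (hO : IsZOrder O) {p : ℕ} (hp : p.Prime) (c a : ℕ)
    (hf₁ : ∀ (i : RightIdealClass O) (K : Subideal O (RightIdealClass.rep i) (p ^ (a + 1) * p)),
      ((K.1 : invertibleRightIdeals O) : Submodule ℤ B) ≤ (p : ℤ) • RightIdealClass.rep i →
        Nat.card (Fibre O (RightIdealClass.rep i) (p ^ (a + 1)) ((K.1 : invertibleRightIdeals O) : Submodule ℤ B)) = c + 1)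
    (hf₂ : ∀ (i : RightIdealClass O) (K : Subideal O (RightIdealClass.rep i) (p ^ (a + 1) * p)),
      ¬ ((K.1 : invertibleRightIdeals O) : Submodule ℤ B) ≤ (p : ℤ) • RightIdealClass.rep i →
        Nat.card (Fibre O (RightIdealClass.rep i) (p ^ (a + 1)) ((K.1 : invertibleRightIdeals O) : Submodule ℤ B)) = 1) :
    (BrandtData.ofOrder O hO).T (p ^ (a + 1)) * (BrandtData.ofOrder O hO).T p =
      (BrandtData.ofOrder O hO).T (p ^ (a + 1) * p) + (c : ℤ) • (BrandtData.ofOrder O hO).T (p ^ a) := by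
  classical
  haveI : IsAddTorsionFree B := isAddTorsionFree_of_charZero_module ℚ B
  obtain ⟨u, hu⟩ := exists_units_eq_natCast (B := B) hp.ne_zero
  ext i k
  set I := RightIdealClass.rep i
  have hIfg : I.FG := (RightIdealClass.isInvertibleRightIdeal_rep i).isFullLattice.1
  haveI : ∀ n, Finite (Subideal O I n) := fun n => Subideal.finite hIfg n
  set S := {K : Subideal O I (p ^ (a + 1) * p) // RightIdealClass.mk K.1 = k}
  letI : Fintype S := Fintype.ofFinite S
  rw [BrandtData.ofOrder_T_mul_T_apply, Matrix.add_apply, Matrix.smul_apply, BrandtData.ofOrder_T,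
    BrandtData.ofOrder_T, subidealCount_eq_card, subidealCount_eq_card,
    card_chain_eq_card_sigma O I (pow_ne_zero _ hp.ne_zero) p k, Nat.card_sigma, smul_eq_mul]
  -- evaluate the fibres
  set P : S → Prop := fun K => ((K.1.1 : invertibleRightIdeals O) : Submodule ℤ B) ≤ (p : ℤ) • I
  have h1 : (∑ K ∈ Finset.univ.filter P, Nat.card (Fibre O I (p ^ (a + 1)) ((K.1.1 : invertibleRightIdeals O) : Submodule ℤ B))) =
      ∑ K ∈ Finset.univ.filter P, (c + 1) :=
    Finset.sum_congr rfl fun K hK => hf₁ i K.1 (Finset.mem_filter.mp hK).2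
  have h2 : (∑ K ∈ Finset.univ.filter (fun K => ¬ P K), Nat.card (Fibre O I (p ^ (a + 1)) ((K.1.1 : invertibleRightIdeals O) : Submodule ℤ B))) =
      ∑ K ∈ Finset.univ.filter (fun K => ¬ P K), 1 :=
    Finset.sum_congr rfl fun K hK => hf₂ i K.1 (Finset.mem_filter.mp hK).2
  rw [← Finset.sum_filter_add_sum_filter_not Finset.univ P, h1, h2,
    Finset.sum_const, Finset.sum_const, smul_eq_mul, smul_eq_mul, mul_one]
  -- the two counts
  have hS : Nat.card {M : Subideal O I (p ^ (a + 1) * p) // RightIdealClass.mk M.1 = k} = Fintype.card S :=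
    Nat.card_eq_fintype_card
  have hfilter : (Finset.univ.filter P).card = Nat.card {K' : Subideal O I (p ^ a) // RightIdealClass.mk K'.1 = k} := by
    let e : {K : Subideal O I (p ^ (a + 1) * p) //
        ((K.1 : invertibleRightIdeals O) : Submodule ℤ B) ≤ (p : ℤ) • I ∧ RightIdealClass.mk K.1 = k} ≃ {K : S // P K} :=
      { toFun := fun K => ⟨⟨K.1, K.2.2⟩, K.2.1⟩
        invFun := fun K => ⟨K.1.1, K.2, K.1.2⟩
        left_inv := fun _ => rfl
        right_inv := fun _ => rfl }
    rw [Nat.card_congr (pSubEquiv O I hp hu a k), Nat.card_congr e, Nat.card_eq_fintype_card, Fintype.card_subtype]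
  have htotal : (Finset.univ.filter P).card + (Finset.univ.filter fun K => ¬ P K).card = Fintype.card S :=
    Finset.card_filter_add_card_filter_not _
  rw [hS, ← hfilter]
  push_cast
  rw [← htotal]
  push_cast
  ring

/-- **Brandt matrices at powers of one prime commute, given the fibre count** (with the same
constant `c` at every level `a`). [cite: VignerasLNM800, Ch. III §5 exercice 5.8 (c)–(d)] -/
theorem BrandtData.ofOrder_commute_T_prime_pow (hO : IsZOrder O) {p : ℕ} (hp : p.Prime) (c : ℕ)
    (hf₁ : ∀ (a : ℕ) (i : RightIdealClass O) (K : Subideal O (RightIdealClass.rep i) (p ^ (a + 1) * p)),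
      ((K.1 : invertibleRightIdeals O) : Submodule ℤ B) ≤ (p : ℤ) • RightIdealClass.rep i →
        Nat.card (Fibre O (RightIdealClass.rep i) (p ^ (a + 1)) ((K.1 : invertibleRightIdeals O) : Submodule ℤ B)) = c + 1)
    (hf₂ : ∀ (a : ℕ) (i : RightIdealClass O) (K : Subideal O (RightIdealClass.rep i) (p ^ (a + 1) * p)),
      ¬ ((K.1 : invertibleRightIdeals O) : Submodule ℤ B) ≤ (p : ℤ) • RightIdealClass.rep i →
        Nat.card (Fibre O (RightIdealClass.rep i) (p ^ (a + 1)) ((K.1 : invertibleRightIdeals O) : Submodule ℤ B)) = 1)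
    (a b : ℕ) :
    Commute ((BrandtData.ofOrder O hO).T (p ^ a)) ((BrandtData.ofOrder O hO).T (p ^ b)) := by
  refine commute_of_recursion (fun a => (BrandtData.ofOrder O hO).T (p ^ a)) ((c : ℤ) • 1)
    (fun a => (Commute.one_left _).smul_left _) (by rw [pow_zero, BrandtData.ofOrder_T_one]) (fun a => ?_) a b
  have h := BrandtData.ofOrder_T_pow_succ_mul_T hO hp c a (hf₁ a) (hf₂ a)
  rw [← pow_succ] at h
  rw [pow_one, h, smul_mul_assoc, one_mul, add_sub_cancel_right]

end Literature.NumberTheory.Automorphic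

end
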